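import Literature.AlgebraicGeometry.Resolution.PointBlowupShade
import Literature.AlgebraicGeometry.Resolution.PointBlowupShadeCentres

/-!
# [OURS · L1 W4.6] Rung (iii) "Moh window" for the classical pair — STATEMENTS of the EXIT half
  (bottom edge, terminal case, finite walks)

Cell `res-hironaka`, rung L (rescue), slot W4.6 (restricted regimes as rungs of the typed Th. 16.6
procedure), rung (iii) «purely inseparable `z^p = f` with `ord f < 2p` (Moh window)», seat
`res-L1-s46-pv-6` (gen 2).  STATEMENT-ONLY file (OURS predicates, no theorem) for the OURS desk,
continuing `MarkedTransferCampaignW46MohWindowShadeStatement.lean` (desk #35: the NO-INCREASE half;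
lane-B reading notes: «NoKangaroo/CentreNoKangaroo are the no-increase half of the Eq. (127) role; Frozen
is instance-free for `|σ| ≤ 2`; Antitone's `∀ n` equimultiplicity = infinite walks only»).  The four
predicates below are the EXIT / DECREASE half for the classical pair; their closers `…_holds` are in
`MarkedTransferCampaignW46MohWindowShadeExitHolds.lean`, the proofs in `…ShadeExit.lean` (p484733) and
`…ShadeTerminal.lean` (p484162), the `decide` certificate in `…ShadeExitCert.lean` (p484914).

Vocabulary (tree, `Literature/AlgebraicGeometry/Resolution/PointBlowupShade.lean`, the typed model of
[Hauser2010, §§F–G]): a STATE `s = (F, r)` of `x^p + F(y)` — `F ∈ K[y_σ]` the residual polynomial, kept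
CLEANED of `p`-th power monomials (`deletePthPowers p F = F`), `y^r` the exceptional monomial (`y^r ∣ F`
monomialwise: `∀ d ∈ supp F, r ≤ d`) —, its shade `ord₀ F − |r|`, the point blow-up
`PointBlowup.step p j b s` (chart `y_j`, point `b` of the exceptional divisor, `b_j = 0`), its new
multiplicities `(step p j b s).r = newMult` (`r'_j = ord₀ F − p`, old components kept iff `b_i = 0`),
`IsEquimultiplePoint` (the transform is again `p`-fold).  A COORDINATE-MONOMIAL ("terminal") state is one
with `ord₀ F = |r|` (shade `0`: `F = y^r · u`, `u(0) ≠ 0`; [HauserPerlega2024, §3] "monomial case", read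
in the given coordinates).  THE WINDOW of regime (iii) is read on the total order `ord₀ F` of the current
state, as in desk #35.

Each predicate carries the parameters `(p, K, σ)` (prime, field of characteristic `p`, finite set of
residual variables); nothing of the manuscript [claim: Hironaka2017, status: under-review] is used or
asserted; the roles named are those the predicates REPLACE in regime (iii), they are NOT statements of the
manuscript.  AI review is weaker than expert review.
-/

noncomputable section

set_option linter.dupNamespace false -- mandated namespace of this single-conjunct summit

namespace Summit.ResolutionOfSingularities.ResolutionOfSingularities.Theorems

open Literature.AlgebraicGeometry.Resolution
open Literature.AlgebraicGeometry.Resolution.Hauser2010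

/-- [OURS · L1 W4.6] replaces the role of the termination clause of Th. 16.13, ms. p. 87 l. 25–29, at the
BOTTOM EDGE of regime (iii) for the classical pair and SURFACES (two residual variables, `σ = {j, i}`):
a cleaned state of `x^p + F(y_j, y_i)` of order EXACTLY `p` has no equimultiple point in the chart `y_j` —
the next point blow-up lowers the order below `p` at every point of the exceptional divisor, the walk of
`p`-fold points ENDS.  (This is why `CampaignW46MohWindowShadeFrozen` has no instance for `|σ| ≤ 2`.)
Hypotheses: `i ≠ j` exhaust `σ`, `b_j = 0`, state cleaned, `ord₀ F = p`.  NOT a statement of the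
manuscript. -/
def CampaignW46MohWindowShadeBottomExit (p : ℕ) (K : Type*) [Field K] [DecidableEq K] [CharP K p]
    (σ : Type*) [Fintype σ] [DecidableEq σ] : Prop :=
  ∀ (j i : σ), i ≠ j → (∀ k, k = j ∨ k = i) → ∀ (b : σ → K), b j = 0 → ∀ s : PointBlowup.State σ K,
    deletePthPowers p s.F = s.F → ordZero s.F = p → ¬ PointBlowup.IsEquimultiplePoint p j b s

/-- [OURS · L1 W4.6] replaces the role of Th. 16.6 (2) / Eq. (127), ms. p. 84 l. 10–20, in regime (iii)
for the classical pair in the TERMINAL CASE («monomial case … a combinatorially given resolution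
process», [HauserPerlega2024, §3 (2)], in the given coordinates), EVERY dimension: for a coordinate-monomial
state (`y^r ∣ F`, `ord₀ F = |r|`) strictly inside the window (`p < |r| < 2p`), at every point `b` of every
chart `y_j` (`b_j = 0`) the new state is again coordinate-monomial — `ord₀ F' = |r'|`, shade `0` — and the
point is equimultiple iff `p ≤ |r'|`: the classical pair's dynamics there IS the game `r ↦ r'` on the
exceptional multiplicities.  NOT a statement of the manuscript. -/
def CampaignW46MohWindowShadeTerminalStable (p : ℕ) (K : Type*) [Field K] [DecidableEq K] [CharP K p]
    (σ : Type*) [Fintype σ] [DecidableEq σ] : Prop :=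
  ∀ (j : σ) (b : σ → K), b j = 0 → ∀ s : PointBlowup.State σ K,
    (∀ d ∈ s.F.support, s.r ≤ d) → ordZero s.F = (s.r.degree : ℕ) → p < s.r.degree →
    s.r.degree < 2 * p →
    ordZero (PointBlowup.step p j b s).F = ((PointBlowup.step p j b s).r.degree : ℕ) ∧
      (PointBlowup.step p j b s).shade = 0 ∧
      (PointBlowup.IsEquimultiplePoint p j b s ↔ p ≤ (PointBlowup.step p j b s).r.degree)

/-- [OURS · L1 W4.6] replaces the role of the termination clause of Th. 16.13, ms. p. 87 l. 25–29, in
regime (iii) for the classical pair in the TERMINAL CASE, every dimension: from a cleaned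
coordinate-monomial state inside the window (`p < |r| < 2p`) in which every PROPER set of exceptional
components has total multiplicity `< p` (`∀ k, Σ_{i ≠ k} r_i < p`: no positive-dimensional coordinate
centre lies in the `p`-fold locus; the complementary case is the permissible centre of desk #35's
`CampaignW46MohWindowShadeCentreNoKangaroo`), every walk `s_{n+1} = step p (j n) (b n) (s n)`
(`b n (j n) = 0`) whose first `N` points are equimultiple has `N + p ≤ |r₀|` — fewer than `|r₀| − p < p`
blow-ups of `p`-fold points.  NOT a statement of the manuscript. -/
def CampaignW46MohWindowShadeTerminalTerminates (p : ℕ) (K : Type*) [Field K] [DecidableEq K]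
    [CharP K p] (σ : Type*) [Fintype σ] [DecidableEq σ] : Prop :=
  ∀ (s : ℕ → PointBlowup.State σ K) (j : ℕ → σ) (b : ℕ → σ → K), (∀ n, b n (j n) = 0) →
    (∀ n, s (n + 1) = PointBlowup.step p (j n) (b n) (s n)) →
    deletePthPowers p (s 0).F = (s 0).F → (∀ d ∈ (s 0).F.support, (s 0).r ≤ d) →
    ordZero (s 0).F = ((s 0).r.degree : ℕ) → p < (s 0).r.degree → (s 0).r.degree < 2 * p →
    (∀ k, ∑ i ∈ Finset.univ.erase k, (s 0).r i < p) →
    ∀ N : ℕ, (∀ n, n < N → PointBlowup.IsEquimultiplePoint p (j n) (b n) (s n)) →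
    N + p ≤ (s 0).r.degree

/-- [OURS · L1 W4.6] the FINITE-WALK form of desk #35's `CampaignW46MohWindowShadeAntitone` (role: the
monotonicity half of the repeated procedure §16.3 / Th. 16.13, ms. p. 87 l. 26–29, in regime (iii), for
the classical pair): along a walk of `N` equimultiple point blow-ups from a cleaned state with `y^r ∣ F`
and `ord₀ F ≥ p` whose states stay in the window for `n < N`, the shade is non-increasing up to `N` —
equimultiplicity and the window are asked only for the `N` steps taken.  NOT a statement of the
manuscript. -/
def CampaignW46MohWindowShadeAntitoneFin (p : ℕ) (K : Type*) [Field K] [DecidableEq K] [CharP K p]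
    (σ : Type*) [Fintype σ] [DecidableEq σ] : Prop :=
  ∀ (s : ℕ → PointBlowup.State σ K) (j : ℕ → σ) (b : ℕ → σ → K), (∀ n, b n (j n) = 0) →
    (∀ n, s (n + 1) = PointBlowup.step p (j n) (b n) (s n)) →
    deletePthPowers p (s 0).F = (s 0).F → (∀ d ∈ (s 0).F.support, (s 0).r ≤ d) →
    (p : ℕ∞) ≤ ordZero (s 0).F → ∀ N : ℕ,
    (∀ n, n < N → PointBlowup.IsEquimultiplePoint p (j n) (b n) (s n)) →
    (∀ n, n < N → ordZero (s n).F < (2 * p : ℕ)) →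
    ∀ n m : ℕ, n ≤ m → m ≤ N → (s m).shade ≤ (s n).shade


/-! ## v2 (gen 2, 02:20Z; APPEND-ONLY): the terminal case under coordinate centres, and the fixed point -/

/-- [OURS · L1 W4.6] replaces the role of Th. 16.6 (2) / Eq. (127), ms. p. 84 l. 4–20 («any smooth closed
irreducible subscheme `D` of `∇(E)` such that the blowup … with center `D` is permissible»), in regime
(iii) for the classical pair in the TERMINAL CASE under COORDINATE CENTRES, every dimension: a
coordinate-monomial state (`y^r ∣ F`, `ord₀ F = |r|`) strictly inside the window (`p < |r| < 2p`), blown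
up along a permissible coordinate centre `C_S` (`j ∈ S`, `Σ_S r ≥ p`; tree model `CentreBlowup`,
[HauserPerlega2019PRIMS, §2]) and read at a point `b` over the origin (`b_j = 0`, `b_i = 0` off `S`), is
again coordinate-monomial (`ord₀ F' = |r'|`, shade `0`), the point is equimultiple iff `p ≤ |r'|`, and if
`S` is minimal at the chart index (`Σ_{S∖{j}} r < p`) the order DROPS, `|r'| < |r|` ("combinatorial
resolution", [HauserPerlega2024, §3 (2)], in the model).  NOT a statement of the manuscript. -/
def CampaignW46MohWindowShadeTerminalCentreStable (p : ℕ) (K : Type*) [Field K] [DecidableEq K]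
    [CharP K p] (σ : Type*) [Fintype σ] [DecidableEq σ] : Prop :=
  ∀ (S : Finset σ) (j : σ), j ∈ S → ∀ b : σ → K, b j = 0 → (∀ i, i ∉ S → b i = 0) →
    ∀ s : CentreBlowup.CState σ K, (∀ d ∈ s.F.support, s.r ≤ d) →
    ordZero s.F = (s.r.degree : ℕ) → p < s.r.degree → s.r.degree < 2 * p →
    p ≤ CentreBlowup.degIn S s.r →
    ordZero (CentreBlowup.step p S j b s).F = ((CentreBlowup.step p S j b s).r.degree : ℕ) ∧
      (CentreBlowup.step p S j b s).shade = 0 ∧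
      (CentreBlowup.IsEquimultiplePoint p S j b s ↔ p ≤ (CentreBlowup.step p S j b s).r.degree) ∧
      (CentreBlowup.degIn (S.erase j) s.r < p → (CentreBlowup.step p S j b s).r.degree < s.r.degree)

/-- [OURS · L1 W4.6] replaces the role of the termination clause of Th. 16.13, ms. p. 87 l. 25–29, in
regime (iii) for the classical pair in the TERMINAL CASE under MINIMAL permissible coordinate centres,
every dimension: along any walk `s_{n+1} = CentreBlowup.step p (S n) (j n) (b n) (s n)` with
`j n ∈ S n`, `Σ_{S n} r_n ≥ p`, `Σ_{S n ∖ {i}} r_n < p` (`i ∈ S n`), points over the origin, from a cleaned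
coordinate-monomial state inside the window, if the first `N` points are equimultiple then
`N + p ≤ |r₀|` («the combinatorial resolution process terminates in finitely many steps»,
[HauserPerlega2024, §3 (2)], in the model).  NOT a statement of the manuscript. -/
def CampaignW46MohWindowShadeTerminalCentreTerminates (p : ℕ) (K : Type*) [Field K] [DecidableEq K]
    [CharP K p] (σ : Type*) [Fintype σ] [DecidableEq σ] : Prop :=
  ∀ (s : ℕ → CentreBlowup.CState σ K) (S : ℕ → Finset σ) (j : ℕ → σ) (b : ℕ → σ → K),
    (∀ n, j n ∈ S n) → (∀ n, b n (j n) = 0) → (∀ n i, i ∉ S n → b n i = 0) →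
    (∀ n, s (n + 1) = CentreBlowup.step p (S n) (j n) (b n) (s n)) →
    (∀ n, p ≤ CentreBlowup.degIn (S n) (s n).r) →
    (∀ n, ∀ i ∈ S n, CentreBlowup.degIn ((S n).erase i) (s n).r < p) →
    deletePthPowers p (s 0).F = (s 0).F → (∀ d ∈ (s 0).F.support, (s 0).r ≤ d) →
    ordZero (s 0).F = ((s 0).r.degree : ℕ) → p < (s 0).r.degree → (s 0).r.degree < 2 * p →
    ∀ N : ℕ, (∀ n, n < N → CentreBlowup.IsEquimultiplePoint p (S n) (j n) (b n) (s n)) →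
    N + p ≤ (s 0).r.degree

/-- [OURS · L1 W4.6] NEGATIVE-SIDE calibration of regime (iii) for the classical pair (no printed
counterpart; it bounds what the rung can claim for point / coordinate centres): in characteristic `2`,
for surfaces, there is a cleaned state `(F, r)` with `y^r ∣ F`, of order `3` — inside the window `[2, 4)`
— and shade `2`, and an equimultiple point of a chart of the blow-up of the origin at which the step of
the model returns `(F, r)` ITSELF: an infinite walk of equimultiple point blow-ups inside the Moh window
with constant shade (`F = u²y + y³ + u²y³ = y(u + y + uy)²`, `r = (0,1)`, the point `u = 1` of the
`y`-chart; its `2`-fold locus is the non-coordinate curve `u + y + uy = 0`, a monomial case hidden from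
the coordinates).  NOT a statement of the manuscript. -/
def CampaignW46MohWindowShadeFixedPointInWindow (K : Type*) [Field K] [DecidableEq K] [CharP K 2] :
    Prop :=
  ∃ (s : PointBlowup.State (Fin 2) K) (j : Fin 2) (b : Fin 2 → K), b j = 0 ∧
    deletePthPowers 2 s.F = s.F ∧ (∀ d ∈ s.F.support, s.r ≤ d) ∧ ordZero s.F = 3 ∧ s.shade = 2 ∧
    PointBlowup.IsEquimultiplePoint 2 j b s ∧ PointBlowup.step 2 j b s = s


/-! ## v3 (gen 2, APPEND-ONLY): the two-cycle for every characteristic -/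

/-- [OURS · L1 W4.6] NEGATIVE-SIDE calibration of regime (iii) for the classical pair, EVERY characteristic
`p` (no printed counterpart; it bounds what the rung can claim for point / coordinate centres): for
surfaces there are two cleaned states `(F₁, r)`, `(F₂, r)` with `y^r ∣ F`, of order `p + 1` — inside the
window `[p, 2p)` — and shade `p`, swapped by equimultiple point blow-ups of the model
(`F_{±1} = u^p y ± y^{p+1} + u^p y^{p+1}`, `r = (0,1)`, the points `u = ∓1` of the `y`-chart; the
`p`-fold locus of `x^p + F` is a non-coordinate curve, a monomial case hidden from the coordinates):
an infinite walk of equimultiple point blow-ups inside the Moh window with constant shade.  NOT a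
statement of the manuscript. -/
def CampaignW46MohWindowShadeTwoCycleInWindow (p : ℕ) (K : Type*) [Field K] [DecidableEq K]
    [CharP K p] : Prop :=
  ∃ (s₁ s₂ : PointBlowup.State (Fin 2) K) (j : Fin 2) (b₁ b₂ : Fin 2 → K), b₁ j = 0 ∧ b₂ j = 0 ∧
    deletePthPowers p s₁.F = s₁.F ∧ deletePthPowers p s₂.F = s₂.F ∧
    (∀ d ∈ s₁.F.support, s₁.r ≤ d) ∧ (∀ d ∈ s₂.F.support, s₂.r ≤ d) ∧
    ordZero s₁.F = (p + 1 : ℕ) ∧ ordZero s₂.F = (p + 1 : ℕ) ∧ s₁.shade = (p : ℕ) ∧ s₂.shade = (p : ℕ) ∧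
    PointBlowup.IsEquimultiplePoint p j b₁ s₁ ∧ PointBlowup.step p j b₁ s₁ = s₂ ∧
    PointBlowup.IsEquimultiplePoint p j b₂ s₂ ∧ PointBlowup.step p j b₂ s₂ = s₁


/-! ## v4 (gen 2, APPEND-ONLY): no well-founded point measure inside the window -/

/-- [OURS · L1 W4.6] the formal NEGATIVE of a «decrease half» of the Th. 16.6 (2) / Eq. (127) role
(ms. p. 84 l. 10–20) for ARBITRARY point centres in the classical model, every characteristic (lane-B
reading note on desk #35, «NoKangaroo is the no-increase half»): there is no `ℕ`-valued function of the
state of a surface `x^p + F(u,y)` that strictly decreases at every equimultiple point of every chart of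
the blow-up of the origin of every cleaned state with `y^r ∣ F` inside the window `p ≤ ord₀ F < 2p`
(the two-cycle `CampaignW46MohWindowShadeTwoCycleInWindow` forbids it).  NOT a statement of the
manuscript. -/
def CampaignW46MohWindowShadeNoPointMeasure (p : ℕ) (K : Type*) [Field K] [DecidableEq K]
    [CharP K p] : Prop :=
  ¬ ∃ Φ : PointBlowup.State (Fin 2) K → ℕ, ∀ (s : PointBlowup.State (Fin 2) K) (j : Fin 2)
      (b : Fin 2 → K), b j = 0 → deletePthPowers p s.F = s.F → (∀ d ∈ s.F.support, s.r ≤ d) →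
      (p : ℕ∞) ≤ ordZero s.F → ordZero s.F < (2 * p : ℕ) → PointBlowup.IsEquimultiplePoint p j b s →
      Φ (PointBlowup.step p j b s) < Φ s


/-! ## v5 (gen 2, APPEND-ONLY): the decrease laws inside the window -/

/-- [OURS · L1 W4.6] replaces the role of the strict-inequality clause of Th. 16.6 (2) / Eq. (127), ms.
p. 84 l. 10–20, in regime (iii) for the classical pair where the coordinate-bound model has one — the
DECREASE LAW AT EVERY POINT OF A CHART, every dimension: for a state `(F, r)` with `y^r ∣ F` and order `o`
strictly inside the window (`p < o < 2p`), if every initial monomial `y^d` of `F` (`|d| = o`) has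
`d_j ≥ r_j + m` (i.e. `y_j^m` divides the initial form of the residual factor `F / y^r`), then at every
point `b` of the chart `y_j` (`b_j = 0`) the shade drops by at least `m`: `shade' + m ≤ shade`.  NOT a
statement of the manuscript. -/
def CampaignW46MohWindowShadeChartDecrease (p : ℕ) (K : Type*) [Field K] [DecidableEq K] [CharP K p]
    (σ : Type*) [Fintype σ] [DecidableEq σ] : Prop :=
  ∀ (j : σ) (b : σ → K), b j = 0 → ∀ (s : PointBlowup.State σ K) (o : ℕ), ordZero s.F = o → p < o →
    o < 2 * p → (∀ d ∈ s.F.support, s.r ≤ d) → ∀ m : ℕ,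
    (∀ d ∈ s.F.support, d.degree = o → s.r j + m ≤ d j) →
    (PointBlowup.step p j b s).shade + m ≤ s.shade

/-- [OURS · L1 W4.6] the same role AT THE ORIGIN of the chart `y_j` (the monomial move), every dimension:
if SOME initial monomial `y^{d₀}` of `F` has `d₀_j ≥ r_j + M`, then at the origin of the chart `y_j` the
shade drops by at least `M` — so a stall at the origin forces the initial form of the residual factor to
be free of `y_j`.  NOT a statement of the manuscript. -/
def CampaignW46MohWindowShadeOriginDecrease (p : ℕ) (K : Type*) [Field K] [DecidableEq K] [CharP K p]
    (σ : Type*) [Fintype σ] [DecidableEq σ] : Prop :=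
  ∀ (j : σ) (b : σ → K), (∀ i, b i = 0) → ∀ (s : PointBlowup.State σ K) (o : ℕ), ordZero s.F = o →
    p < o → o < 2 * p → (∀ d ∈ s.F.support, s.r ≤ d) → ∀ (M : ℕ) (d₀ : σ →₀ ℕ), d₀ ∈ s.F.support →
    d₀.degree = o → s.r j + M ≤ d₀ j → (PointBlowup.step p j b s).shade + M ≤ s.shade

end Summit.ResolutionOfSingularities.ResolutionOfSingularities.Theorems
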